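import Mathlib
import HarnessLib
import HarnessLib.Audit
import Summits.HodgeConjecture.Statement
import Literature.AlgebraicGeometry.Tropical.KugaSatakeLinearFamily
import Literature.AlgebraicGeometry.Tropical.TropicalTorusWeilCycles
import Literature.Geometry.Kaehler.ComplexTorus
import Literature.NumberTheory.Transcendental.Analytification
import Literature.AlgebraicGeometry.HodgeTheory.HodgeConjecture
import HarnessLib.Audit.Status.Attr

/-!
Route: TropicalKugaSatakeCayley

# Route TropicalKugaSatakeCayley — effective tropical 2-cycles on the rank-7 Kuga–Satake tori carry
only theta, so the Cayley classes of so(7)-type eightfolds are not algebraic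

REFUTATION route (the deciding theorem concludes `¬ HodgeConjecture`), typing the sketch
tropical-kuga-satake-cayley. It suffices to show
X = K1 ∧ K2 ∧ K3 over the explicit integral rank-7 Kuga–Satake linear family `B_t = Σ t_i • ksForm
i` (t in the positive cone
`ksPosCone ⊂ ℝ⁵`; `Literature.AlgebraicGeometry.Tropical.KugaSatakeLinearFamily`) and the framed
simplicial tropical 2-chains of the
tropical tori `ℝ⁸ / B_t ℤ⁸` (`TropicalTorus.Chain ℝ 8 2`, `IsCycle`, `Effective`, `classOf`; period
coordinates
`compound 2 B_t⁻¹ · classOf`, theta direction `1`). K1 (EffectiveCayleyNonRealizability, the bet): a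
period class realised by EFFECTIVE
tropical 2-cycles at every parameter of a non-empty open subset of the cone is a multiple of the
theta class `θ⁶ ↔ 1`. K3
(FormalCycleCriterion, Kontsevich's formal cycles): an effective 2-cycle at a parameter with
ℚ-linearly independent coordinates extends,
with constant period class, to effective 2-cycles over a non-empty open set. K2
(KontsevichTransferKS, the transfer): for some `z` in the
tube domain over the cone, on every smooth projective model `X` of the principally polarised torus
`ℂ⁸/(ℤ⁸ ⊕ (Σ z_i ksForm i)ℤ⁸)`, any `a`
linearly independent rational algebraic (6,6)-classes are shadowed, on a non-empty open set of
tropical parameters, by `a` effective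
tropical 2-cycles with ℝ-independent period classes. Supports: S3 a projective model exists
(Lefschetz), S5 the model carries two independent rational (6,6)-classes (θ⁶ and a Cayley
class; van Geemen–Verra Cor. 6.5); that open sets of ℝ⁵ contain ℚ-generic parameters (Baire) is
proved inside the Assembly item.
Lean: `EffectiveCayleyNonRealizability ∧ KontsevichTransferKS ∧ FormalCycleCriterion`

## Assembly
Pure logic plus `LinearIndependent.pair_iff` and Baire (sorry-free in Sketch.lean as
`assembly_of_qGeneric`, modulo the Baire lemma
'every non-empty open U ⊆ ℝ⁵ contains a point with ℚ-linearly independent coordinates', left to the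
prover of the Assembly item): assume
HC. K2 gives `z`; S3 gives a model `(Φ, X, φ)`; S5 gives two independent rational (6,6)-classes,
algebraic by HC; K2 (a = 2) gives an open
`U` and, at a ℚ-generic `t ∈ U`, two effective tropical 2-cycles with ℝ-independent period classes;
K3 spreads each over an open set with
constant class and K1 makes each class a multiple of `1`; two multiples of `1` are dependent —
contradiction. The deciding theorem
`closes` consumes the Assembly item and the five statements (modus ponens).

Rationale: WHY THIS LINE. Kontsevich's specialisation test (Zharkov2020TropicalWeil pp. 2–3;
AminiPiquerez2020TropicalHC Thm. 1.1 and p. 3) says that algebraic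
cycles on the fibres of a maximally degenerating family of abelian varieties leave EFFECTIVE
tropical cycles on the limiting tropical
tori, with vertices varying rationally in the degeneration parameters; it was aimed at Weil classes
on fourfolds, which Markman has
since proved algebraic (arXiv:2509.23403, Markman2025SecantWeil), so that test can no longer bite
there. We point it at the first
exceptional classes that are neither divisorial nor of Weil/PEL type: the five Cayley classes
`B²(A)₀` (dually in degree 12) of the
abelian eightfolds of `so(7)`-type (vanGeemenVerra2003QuaternionicPryms §6: Prop. 6.2, Cor. 6.5,
Lemma 6.8; their Hodge (2,2)
conjecture is stated open on p. 2), realised as the 5-parameter Kuga–Satake family whose cusp data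
is an explicit CLIFFORD linear
family of integral quadratic forms (`ksForm`, `ksClifford_sq`, `ksClifford_anticomm`). Imported:
tropical homology of tori and the
eigenwave (MikhalkinZharkov2014Eigenwave §5–6), Mumford/Faltings–Chai degenerations
(FaltingsChai1990 Ch. III) for K2, spin
representation theory (vGV §6.3–6.8) for S5, Baire category inside the assembly. New relative to the
hub: no Hodge route uses tropical
non-realisability; relative to the prior programme's unfinished line (archived
hodge-neg/tropical-kuga-satake, paper-v2 Thms A–E, T):
the tropical bet is weakened to EFFECTIVE cycles and to OPEN (not very-general) realisability, which
is exactly what the transfer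
delivers and what `closes` consumes, and the whole statement is typed over one explicit lattice.

RANKED CRUXES. #2 EffectiveCayleyNonRealizability (crux) — K1 (card K1, effective + open form of the
prior programme's statement W). For every non-empty open `U ⊆ ksPosCone` and every real matrix `M`
on `Sub 8 2 × Sub 8 2`: if for every `t ∈ U` some framed simplicial 2-chain `Z` of `ℝ⁸/B_tℤ⁸` is a
cycle (`IsCycle (ksMatrix t)`), is effective, and has period class `compound 2 (ksMatrix t)⁻¹ ·
Z.classOf = M`, then `M = r • 1` for some real `r` (a multiple of the class of `θ⁶`). Equivalently
(given MZ Thm. 5.4): no class with non-zero Cayley component is effectively realisable locally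
constantly in `t`. [difficulty: open-problem] (why it might fail: Nothing forbids an effective
2-cycle with Cayley component whose combinatorial type is flexible along all five directions of F
(paper-v2 Thm. D: only 'F ⊆ D(Z)' is needed); excess pieces of triple intersections of 2-torsion
theta translates are untested candidates.) [MikhalkinZharkov2014Eigenwave, Zharkov2020TropicalWeil,
AminiPiquerez2020TropicalHC, vanGeemenVerra2003QuaternionicPryms]
#3 KontsevichTransferKS (crux) — K2 (card K2, Kontsevich's specialisation made precise for this
family). There is `z ∈ ℂ⁵` with `Im z ∈ ksPosCone` such that for every period isomorphism `Φ` of `z`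
(`IsKSPeriodMap z Φ`), every smooth projective `X/ℂ` of dimension 8 with an analytification `φ :
ComplexTorus Φ → X(ℂ)`, every `a` and every ℂ-linearly independent family `α : Fin a → H¹²(X(ℂ), ℂ)`
of rational (6,6)-classes lying in `algebraicClasses X 6`, there is a non-empty open `U ⊆ ksPosCone`
such that for every `t ∈ U` there are effective tropical 2-cycles `Z₁,…,Z_a` of `ℝ⁸/B_tℤ⁸` whose
period classes are ℝ-linearly independent. Intended proof: `z` very general in the tube domain;
subvarieties of `A_z` spread over the Kuga–Satake Shimura variety to a neighbourhood of the cusp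
(Mumford–Faltings–Chai family of the forms `ksForm i`), tropicalise to effective cycles along an
open cone of directions with period class = leading graded piece of the cycle class, and the
leading-graded-piece map is injective on Hodge classes of the very general fibre (dictionary).
[difficulty: XL] (why it might fail: Spreading cycles from the very general A_z to a neighbourhood
of the cusp needs algebraicity of the family at the boundary (toroidal compactification of the
Spin(2,5) Shimura variety) plus base change; and the leading graded piece might kill an algebraic
class (weight drop), losing independence.) [Zharkov2020TropicalWeil, FaltingsChai1990,
AminiPiquerez2020TropicalHC, MikhalkinZharkov2014Eigenwave, arXiv:2507.15695]
#4 FormalCycleCriterion (crux) — K3 (card K3, Kontsevich's 'formal cycles' / paper-v2 Thm. C in the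
form the assembly needs). If `t ∈ ksPosCone` has ℚ-linearly independent coordinates and `Z` is an
effective tropical 2-cycle of `ℝ⁸/B_tℤ⁸`, then there is a non-empty open `U ⊆ ksPosCone` such that
for every `t' ∈ U` some effective tropical 2-cycle `Z'` of `ℝ⁸/B_{t'}ℤ⁸` has the same period class
as `Z`. Intended proof: the incidences of `Z` (which faces are period translates, by which integer
vectors) are homogeneous ℚ-LINEAR equations in (t', vertices, edge coefficients) because `B_{t'} k`
is linear in `t'`; the rational solution space projects onto a rational subspace of ℝ⁵ containing
the ℚ-generic `t`, hence onto ℝ⁵; a linear section keeps effectivity nearby and keeps `IsCycle`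
(merging zero-sum face groups); the period class of a cycle is rational (homology) and continuous
along the section, hence constant. [difficulty: L] (why it might fail: Constancy needs 'the period
class of every IsCycle chain is rational' (homology invariance of the tautological class) for the
sibling chain encoding, unproved; and new face coincidences along the linear section must keep
IsCycle (zero-sum groups merge) under boundaryCoeff's ordered bookkeeping.)
[Zharkov2020TropicalWeil, MikhalkinZharkov2014Eigenwave, AminiPiquerez2020TropicalHC]
#9 KSModelExists (support) — S3 (Lefschetz + Chow): for `Im z ∈ ksPosCone` the matrix `τ(z) = Σ z_i
ksForm i` is symmetric with positive-definite imaginary part, so `(x,y) ↦ x + τ(z)y` is a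
real-linear isomorphism `Φ` (`IsKSPeriodMap z Φ`) and the principally polarised torus `ComplexTorus
Φ = ℂ⁸/(ℤ⁸ ⊕ τℤ⁸)` is the analytification of a smooth projective 8-fold `X/ℂ`. Known (Lefschetz
embedding by theta functions, Chow/GAGA); in-tree provable once a projective-embedding interface for
`IsAnalytification` exists. [difficulty: L] [LangeBirkenhake1992, FaltingsChai1990]
#9 CayleyHodgeRankTwo (support) — S5 (van Geemen–Verra Cor. 6.5 / Lemma 6.8, dual degree): for every
`z` with `Im z ∈ ksPosCone` and every smooth projective model `X` of the torus `ℂ⁸/(ℤ⁸ ⊕ τ(z)ℤ⁸)`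
(data `Φ, φ` as in K2) there are two ℂ-linearly independent rational (6,6)-classes in `H¹²(X(ℂ), ℂ)`
— `θ⁶` and one Cayley class. Risk carried by this item: it rests on identifying the linear family `Σ
z_i ksForm i` with the Spin(2,5)-equivariant (Satake) image of the type-IV₅ tube domain in 𝔥₈ (a
Jordan-algebra homomorphism of cones, paper-v2 Prop. 'Clifford–Jordan structure'), so that the
Spin-invariants (dim B² = dim B⁶ = 6) are Hodge on EVERY member; if the generic Mumford–Tate group
of the family were larger, the rank drops to 1 and the route is moot. [difficulty: L]
[vanGeemenVerra2003QuaternionicPryms, Deligne1982HodgeCycles, vanGeemen1994HodgeAV]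

TWO-LAYER PLAN. K1 ⇐ OpenRealizableIsHodgeF → AllOrNothing → NotAllRealizable → K1 (effective/open
version of paper-v2 Thm. 'Reformulation':
isogeny push-forwards by the Hurwitz order make the span of open-effectively-realisable classes a
D^×-module, and the Cayley part is
absolutely irreducible, vGV Lemma 6.8). K3 ⇐ LinearFamily → ClassesTotallyDisconnected → K3. K2 ⇐
RankTransfer → Selection → K2.
(Registered as birth skeletons; promoted to splits only after a crux closes.)

KILL CRITERIA. ¬K1 by an explicit effective tropical 2-cycle `Z` on a rational Kuga–Satake torus
with non-zero Cayley component and all of F in its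
deformation space (paper-v2 Thm. D criterion) closes the route
`refuted:EffectiveCayleyNonRealizability` — and is itself a theorem worth
having (tropical Hodge conjecture for these tori in degree 2, evidence FOR HC on so(7)-type
eightfolds). ¬S5 (generic Mumford–Tate group
of the linear family is GSp₁₆, rank 1) moots the route: close `refuted:CayleyHodgeRankTwo`. A proof
that `B²` of so(7)-type eightfolds is
algebraic (e.g. via a Prym identification, vGV p. 2, or Markman-type sheaf methods) refutes K2 given
K1, K3: pivot to filing K1 as a
positive tropical theorem and retire. ¬K3 would indicate the chain encoding is wrong, not the
mathematics: repair the statement.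

NOT DECOMPOSED YET. The obstruction functional / exhaustive mechanism for K1 (layer-2:
sixth-flexibility `B₆ ∈ D(Z)`, excess-intersection candidates,
SAT/LP searches over Delaunay data); the Mumford–Faltings–Chai interface and the dictionary (leading
graded piece ≅ `Hdg_p(F)`,
EGS arXiv:2507.15695 Thm. 2.12) inside K2; rationality of cycle classes for the `Chain` encoding
inside K3; the Satake-embedding
identification inside S5. All are children for tenure, not items now.

CHEAPEST FALSIFIER. For S5 (moots everything): a symbolic check that a Cayley-type Spin(7)-invariant
in `∧¹²ℚ¹⁶` stays of type (6,6) along `τ(z) = Σ z_i ksForm i`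
for generic `z` (finite linear algebra over ℚ(z); the prior programme's tropical count `dim
Hdg_p(F_KS) = 1,6,6,16,6,6,1` matching vGV
Cor. 6.5/Rem. 6.6 is the existing evidence). For K1: run the paper-v2 Thm. D criterion on the
smallest excess candidates (triple
intersections of 2-torsion theta translates along F-stably shared facets) — one flexible candidate
with Cayley component kills K1.
Lookup falsifier (done, negative): is HC for so(7)-type eightfolds / Kuga–Satake varieties of
(1,5,1)-structures already proved?
Searched corpus + arXiv + galaxy (see Novelty): only special OG6 moduli members (Floccari,
arXiv:2203.16257 Cor. 2) and Weil-type
results (Markman) — not the general so(7)-type member.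

NUMBERS. `g = 8`, `p = 2` (tropical 2-cycles ↔ codimension-6 algebraic cycles, classes in `H¹²`);
family dimension `m = 5`; cone = nappe of
`⟨1,-1,-2,-2,-2⟩`; `dim Hdg_p(F_KS) = 1, 6, 6, 16, 6, 6, 1` (p = 1…7; paper-v2 Computation 'Tropical
Hodge numbers', = vGV Cor. 6.5,
Rem. 6.6 for p ≤ 4); Cayley part 5-dimensional, absolutely irreducible under `D^× ⊗ ℂ ≅ GL₂(ℂ)` (vGV
Lemma 6.8); `End = D ≅ (-1,-1)_ℚ`;
items at open: 6 (3 cruxes, 2 supports, 1 assembly); `closes` has 6 binders.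

DEFINITION REQUESTS. None now: the KS data landed as
`Literature/AlgebraicGeometry/Tropical/KugaSatakeLinearFamily.lean` (p169707); tropical chains are
the
sibling `TropicalTorusWeilCycles.lean` (shared with the tropical-Weil typing seats, as the reader
verdict asked). Wanted later (not
blocking): a named comparison `H^k(ComplexTorus Φ; ℂ) ≅ ∧^k` in degree 12 and a Mumford-degeneration
interface for K2.

Novelty: Searches (2026-08-17): `lit search --hybrid "so(7) abelian Hodge classes algebraic spin
representation eightfold"` (textbooks only);
`lit search '"so(7)"' --source local` (1 relevant: vGV p. 12); `lit search '"Spin(7)" abelian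
Hodge'` (Ramadas Spin(7)-instantons for Weil
FOURfolds, arXiv:0809.3927 — different objects); `lit search "Kuga-Satake O'Grady sixfolds OG6 Hodge
conjecture abelian" --source all`
(Floccari arXiv:2203.16257 Cor. 2: HC for OG6 varieties K̃_v(A,H) motivated by an abelian surface —
a special sublocus, not the general
(1,5,1) structure; arXiv:2308.02267, 2210.02948: Kum-type, rank-6 case); `lit vsearch "Hodge
conjecture abelian eightfolds so(7) type Kuga-Satake (1,5,1)"` (0 relevant);
`lit citing doi:10.1016/s0040-9383(02)00004-6` (13 citing works, none on B² of so(7)-type); `lit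
galaxy search "so(7)-type|so(7) type abelian|Spin(7) abelian|Cayley class" --star all`
(0 relevant); `lit read arxiv:2012.13142 --grep Kontsevich` (AP Thm. 1.1: tropical HC for RATIONALLY
TRIANGULABLE tropical varieties — generic
KS tori are not); `ledger negatives --problem HodgeConjecture` (3, unrelated); hub routes: no
tropical refutation route (TropicalCuspLift,
retired, was a positive Weil-class route; DeltaPeriodAudit is a period-transcendence refutation
route); NEAREST LISTED ROUTE (born 2026-08-17T16:32Z while this route was being typed):
TropicalWeilObstruction — Kontsevich's test, negative branch, on Weil-type eightfolds (K = ℚ(i)):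
effective tropical 4-cycles, Weil funct  [refs: 10.1016/s0040-9383(02, 0809.3927, 2203.16257, 2308.02267, 2012.13142, doi:10.1016/s0040-9383, arxiv:2012.13142]

Barriers (technique_class: refutation-on-abelian-varieties, tropical-degeneration): - technique_class: refutation-on-abelian-varieties, tropical-degeneration (Kontsevich test, family
rigidity)
- Literature.Barriers.HodgeConjecture.Andre1996_hodgeClassesOnAbelianVarieties_motivated: it does
not evade it; the bet is explicit — Hodge classes on abelian varieties are motivated (André 1996
Thm. 0.6.2), so ¬HC here also refutes Grothendieck's standard conjecture B for some abelian pencil;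
the route accepts that price (B is open) and no step uses B.
- Literature.Barriers.HodgeConjecture.hodgeClassesAreAbsoluteFor_abelianVariety: outside its class —
Deligne's theorem kills Galois-conjugation tests on abelian varieties; the test here is
specialisation of EFFECTIVE cycles to a toric cusp, which absolute-Hodge-ness does not control
(absolute Hodge classes need not have effective tropical shadows).
- Literature.Barriers.HodgeConjecture.CattaniDeligneKaplan1995_hodgeLocus_algebraicFor: outside —
the Cayley classes are Hodge on the whole 5-dimensional Kuga–Satake Shimura family (an algebraic
Hodge locus, CDK-consistent); the route never argues from non-algebraicity of a Hodge locus.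
- Literature.Barriers.HodgeConjecture.Zucker1977_kaehlerTorus_noAnalyticCycles: outside (likewise
Voisin2002_weilTorus_hodgeClassWithoutSubvarieties) — every torus used has `Im τ(z)` positive
definite, i.e. is principally polarised, and S3 makes the projective model explicit; Zucker/Voisin
non-projective tori play no role.
- Literature.Barriers.HodgeConjecture.AtiyahHirzebruch1962_torsionClass

sub-problem: HodgeConjecture · status: draft · opened planner-type-0185f1385c-0 2026-08-17T16:42:58Z · rev 0 · ledger route-HodgeConjecture-TropicalKugaSatakeCayley
GENERATED by the gate from the ledger (D-0016/17). Provers cite these decls: `theorem foo : Summit.HodgeConjecture.HodgeConjecture.Theses.TropicalKugaSatakeCayley.<Decl> := …` in Summits/HodgeConjecture/HodgeConjecture/Theorems/<Name>.lean.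
-/

namespace Summit.HodgeConjecture.HodgeConjecture.Theses.TropicalKugaSatakeCayley

open scoped BigOperators Topology Manifold Classical MeasureTheory ProbabilityTheory Matrix InnerProductSpace ComplexConjugate ContinuousMap
open Filter Set Function TopologicalSpace MeasureTheory

attribute [summit_statement] _root_.HodgeConjecture

/-- item stmt-HodgeConjecture-18569 · crux · rank 2 · open · by planner
why it might fail: Nothing forbids an effective 2-cycle with Cayley component whose combinatorial type is flexible along all five directions of F (paper-v2 Thm. D: only 'F ⊆ D(Z)' is needed); excess pieces of triple intersections of 2-torsion theta translates are untested candidates.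
sources: MikhalkinZharkov2014Eigenwave, Zharkov2020TropicalWeil, AminiPiquerez2020TropicalHC, vanGeemenVerra2003QuaternionicPryms
[crux] K1 (card K1, effective + open form of the prior programme's statement W). For every non-empty
open `U ⊆ ksPosCone` and every real matrix `M` on `Sub 8 2 × Sub 8 2`: if for every `t ∈ U` some
framed simplicial 2-chain `Z` of `ℝ⁸/B_tℤ⁸` is a cycle (`IsCycle (ksMatrix t)`), is effective, and
has period class `compound 2 (ksMatrix t)⁻¹ · Z.classOf = M`, then `M = r • 1` for some real `r` (a
multiple of the class of `θ⁶`). Equivalently (given MZ Thm. 5.4): no class with non-zero Cayley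
component is effectively realisable locally constantly in `t`. [difficulty: open-problem] -/
@[route_item "route-HodgeConjecture-TropicalKugaSatakeCayley", crux]
def EffectiveCayleyNonRealizability : Prop :=
  ∀ U : Set (Fin 5 → ℝ), IsOpen U → U.Nonempty → U ⊆ Literature.AlgebraicGeometry.Tropical.ksPosCone → ∀ M : Matrix (Literature.AlgebraicGeometry.Tropical.TropicalTorus.Sub 8 2) (Literature.AlgebraicGeometry.Tropical.TropicalTorus.Sub 8 2) ℝ, (∀ t ∈ U, ∃ Z : Literature.AlgebraicGeometry.Tropical.TropicalTorus.Chain ℝ 8 2, Z.IsCycle (Literature.AlgebraicGeometry.Tropical.ksMatrix t) ∧ Z.Effective ∧ Literature.AlgebraicGeometry.Tropical.TropicalTorus.compound 2 (Literature.AlgebraicGeometry.Tropical.ksMatrix t)⁻¹ * Z.classOf = M) → ∃ r : ℝ, M = r • (1 : Matrix (Literature.AlgebraicGeometry.Tropical.TropicalTorus.Sub 8 2) (Literature.AlgebraicGeometry.Tropical.TropicalTorus.Sub 8 2) ℝ)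

/-- item stmt-HodgeConjecture-18570 · crux · rank 3 · open · by planner
why it might fail: Spreading cycles from the very general A_z to a neighbourhood of the cusp needs algebraicity of the family at the boundary (toroidal compactification of the Spin(2,5) Shimura variety) plus base change; and the leading graded piece might kill an algebraic class (weight drop), losing independence.
sources: Zharkov2020TropicalWeil, FaltingsChai1990, AminiPiquerez2020TropicalHC, MikhalkinZharkov2014Eigenwave, arXiv:2507.15695
[crux] K2 (card K2, Kontsevich's specialisation made precise for this family). There is `z ∈ ℂ⁵`
with `Im z ∈ ksPosCone` such that for every period isomorphism `Φ` of `z` (`IsKSPeriodMap z Φ`),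
every smooth projective `X/ℂ` of dimension 8 with an analytification `φ : ComplexTorus Φ → X(ℂ)`,
every `a` and every ℂ-linearly independent family `α : Fin a → H¹²(X(ℂ), ℂ)` of rational
(6,6)-classes lying in `algebraicClasses X 6`, there is a non-empty open `U ⊆ ksPosCone` such that
for every `t ∈ U` there are effective tropical 2-cycles `Z₁,…,Z_a` of `ℝ⁸/B_tℤ⁸` whose period
classes are ℝ-linearly independent. Intended proof: `z` very general in the tube domain;
subvarieties of `A_z` spread over the Kuga–Satake Shimura variety to a neighbourhood of the cusp
(Mumford–Faltings–Chai family of the forms `ksForm i`), tropicalise to effective cycles along an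
open cone of directions with period class = leading graded piece of the cycle class, and the
leading-graded-piece map is injective on Hodge classes of the very general fibre (dictionary).
[difficulty: XL] -/
@[route_item "route-HodgeConjecture-TropicalKugaSatakeCayley", crux]
def KontsevichTransferKS : Prop :=
  ∃ z : Fin 5 → ℂ, (fun i => (z i).im) ∈ Literature.AlgebraicGeometry.Tropical.ksPosCone ∧ ∀ (Φ : (Fin 8 ⊕ Fin 8 → ℝ) ≃L[ℝ] (Fin 8 → ℂ)), Literature.AlgebraicGeometry.Tropical.IsKSPeriodMap z Φ → ∀ (X : Literature.AlgebraicGeometry.Motives.SchemeOver ℂ), Literature.AlgebraicGeometry.Motives.IsSmoothProjective 8 X → ∀ (φ : Literature.Geometry.Kaehler.ComplexTorus Φ → Literature.AlgebraicGeometry.Motives.ComplexPoints X), Literature.NumberTheory.Transcendental.IsAnalytification (Fin 8 → ℂ) X 8 φ → ∀ (a : ℕ) (α : Fin a → Literature.AlgebraicGeometry.HodgeTheory.complexBetti X (2 * 6)), LinearIndependent ℂ α → (∀ i, Literature.AlgebraicGeometry.HodgeTheory.IsRationalClass (α i) ∧ Literature.AlgebraicGeometry.HodgeTheory.IsOfHodgeType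 8 X (2 * 6) 6 6 (α i) ∧ α i ∈ Literature.AlgebraicGeometry.HodgeTheory.algebraicClasses X 6) → ∃ U : Set (Fin 5 → ℝ), IsOpen U ∧ U.Nonempty ∧ U ⊆ Literature.AlgebraicGeometry.Tropical.ksPosCone ∧ ∀ t ∈ U, ∃ Z : Fin a → Literature.AlgebraicGeometry.Tropical.TropicalTorus.Chain ℝ 8 2, (∀ i, (Z i).IsCycle (Literature.AlgebraicGeometry.Tropical.ksMatrix t) ∧ (Z i).Effective) ∧ LinearIndependent ℝ (fun i => Literature.AlgebraicGeometry.Tropical.TropicalTorus.compound 2 (Literature.AlgebraicGeometry.Tropical.ksMatrix t)⁻¹ * (Z i).classOf)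

/-- item stmt-HodgeConjecture-18571 · crux · rank 4 · closed · proved by Summit.HodgeConjecture.HodgeConjecture.Theorems.formalCycleCriterion_proof @ 5b6727a19496 (prover) · by planner
why it might fail: Constancy needs 'the period class of every IsCycle chain is rational' (homology invariance of the tautological class) for the sibling chain encoding, unproved; and new face coincidences along the linear section must keep IsCycle (zero-sum groups merge) under boundaryCoeff's ordered bookkeeping.
sources: Zharkov2020TropicalWeil, MikhalkinZharkov2014Eigenwave, AminiPiquerez2020TropicalHC
[crux] K3 (card K3, Kontsevich's 'formal cycles' / paper-v2 Thm. C in the form the assembly needs).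
If `t ∈ ksPosCone` has ℚ-linearly independent coordinates and `Z` is an effective tropical 2-cycle
of `ℝ⁸/B_tℤ⁸`, then there is a non-empty open `U ⊆ ksPosCone` such that for every `t' ∈ U` some
effective tropical 2-cycle `Z'` of `ℝ⁸/B_{t'}ℤ⁸` has the same period class as `Z`. Intended proof:
the incidences of `Z` (which faces are period translates, by which integer vectors) are homogeneous
ℚ-LINEAR equations in (t', vertices, edge coefficients) because `B_{t'} k` is linear in `t'`; the
rational solution space projects onto a rational subspace of ℝ⁵ containing the ℚ-generic `t`, hence
onto ℝ⁵; a linear section keeps effectivity nearby and keeps `IsCycle` (merging zero-sum face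
groups); the period class of a cycle is rational (homology) and continuous along the section, hence
constant. [difficulty: L] -/
@[route_item "route-HodgeConjecture-TropicalKugaSatakeCayley", crux]
def FormalCycleCriterion : Prop :=
  ∀ t : Fin 5 → ℝ, t ∈ Literature.AlgebraicGeometry.Tropical.ksPosCone → LinearIndependent ℚ t → ∀ Z : Literature.AlgebraicGeometry.Tropical.TropicalTorus.Chain ℝ 8 2, Z.IsCycle (Literature.AlgebraicGeometry.Tropical.ksMatrix t) → Z.Effective → ∃ U : Set (Fin 5 → ℝ), IsOpen U ∧ U.Nonempty ∧ U ⊆ Literature.AlgebraicGeometry.Tropical.ksPosCone ∧ ∀ t' ∈ U, ∃ Z' : Literature.AlgebraicGeometry.Tropical.TropicalTorus.Chain ℝ 8 2, Z'.IsCycle (Literature.AlgebraicGeometry.Tropical.ksMatrix t') ∧ Z'.Effective ∧ Literature.AlgebraicGeometry.Tropical.TropicalTorus.compound 2 (Literature.AlgebraicGeometry.Tropical.ksMatrix t')⁻¹ * Z'.classOf = Literature.AlgebraicGeometry.Tropical.TropicalTorus.compound 2 (Literature.AlgebraicGeometry.Tropical.ksMatrix t)⁻¹ * Z.classOf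

/-- item stmt-HodgeConjecture-18572 · support · rank 9 · closed · proved by Summit.HodgeConjecture.HodgeConjecture.Theorems.ksModelExists_proof @ 6ad170f568cd (prover) · by planner
sources: LangeBirkenhake1992, FaltingsChai1990
[support] S3 (Lefschetz + Chow): for `Im z ∈ ksPosCone` the matrix `τ(z) = Σ z_i ksForm i` is
symmetric with positive-definite imaginary part, so `(x,y) ↦ x + τ(z)y` is a real-linear isomorphism
`Φ` (`IsKSPeriodMap z Φ`) and the principally polarised torus `ComplexTorus Φ = ℂ⁸/(ℤ⁸ ⊕ τℤ⁸)` is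
the analytification of a smooth projective 8-fold `X/ℂ`. Known (Lefschetz embedding by theta
functions, Chow/GAGA); in-tree provable once a projective-embedding interface for
`IsAnalytification` exists. [difficulty: L] -/
@[route_item "route-HodgeConjecture-TropicalKugaSatakeCayley", crux]
def KSModelExists : Prop :=
  ∀ z : Fin 5 → ℂ, (fun i => (z i).im) ∈ Literature.AlgebraicGeometry.Tropical.ksPosCone → ∃ (Φ : (Fin 8 ⊕ Fin 8 → ℝ) ≃L[ℝ] (Fin 8 → ℂ)) (_ : Literature.AlgebraicGeometry.Tropical.IsKSPeriodMap z Φ) (X : Literature.AlgebraicGeometry.Motives.SchemeOver ℂ) (_ : Literature.AlgebraicGeometry.Motives.IsSmoothProjective 8 X) (φ : Literature.Geometry.Kaehler.ComplexTorus Φ → Literature.AlgebraicGeometry.Motives.ComplexPoints X), Literature.NumberTheory.Transcendental.IsAnalytification (Fin 8 → ℂ) X 8 φ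

/-- item stmt-HodgeConjecture-18573 · support · rank 9 · closed · proved by Summit.HodgeConjecture.HodgeConjecture.Theorems.cayleyHodgeRankTwo_proof @ ced441dfe70d (prover) · by planner
sources: vanGeemenVerra2003QuaternionicPryms, Deligne1982HodgeCycles, vanGeemen1994HodgeAV
[support] S5 (van Geemen–Verra Cor. 6.5 / Lemma 6.8, dual degree): for every `z` with `Im z ∈
ksPosCone` and every smooth projective model `X` of the torus `ℂ⁸/(ℤ⁸ ⊕ τ(z)ℤ⁸)` (data `Φ, φ` as in
K2) there are two ℂ-linearly independent rational (6,6)-classes in `H¹²(X(ℂ), ℂ)` — `θ⁶` and one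
Cayley class. Risk carried by this item: it rests on identifying the linear family `Σ z_i ksForm i`
with the Spin(2,5)-equivariant (Satake) image of the type-IV₅ tube domain in 𝔥₈ (a Jordan-algebra
homomorphism of cones, paper-v2 Prop. 'Clifford–Jordan structure'), so that the Spin-invariants (dim
B² = dim B⁶ = 6) are Hodge on EVERY member; if the generic Mumford–Tate group of the family were
larger, the rank drops to 1 and the route is moot. [difficulty: L] -/
@[route_item "route-HodgeConjecture-TropicalKugaSatakeCayley", crux]
def CayleyHodgeRankTwo : Prop :=
  ∀ z : Fin 5 → ℂ, (fun i => (z i).im) ∈ Literature.AlgebraicGeometry.Tropical.ksPosCone → ∀ (Φ : (Fin 8 ⊕ Fin 8 → ℝ) ≃L[ℝ] (Fin 8 → ℂ)), Literature.AlgebraicGeometry.Tropical.IsKSPeriodMap z Φ → ∀ (X : Literature.AlgebraicGeometry.Motives.SchemeOver ℂ), Literature.AlgebraicGeometry.Motives.IsSmoothProjective 8 X → ∀ (φ : Literature.Geometry.Kaehler.ComplexTorus Φ → Literature.AlgebraicGeometry.Motives.ComplexPoints X), Literature.NumberTheory.Transcendental.IsAnalytification (Fin 8 → ℂ) X 8 φ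 → ∃ c : Fin 2 → Literature.AlgebraicGeometry.HodgeTheory.complexBetti X (2 * 6), (∀ i, Literature.AlgebraicGeometry.HodgeTheory.IsRationalClass (c i)) ∧ (∀ i, Literature.AlgebraicGeometry.HodgeTheory.IsOfHodgeType 8 X (2 * 6) 6 6 (c i)) ∧ LinearIndependent ℂ c

/-- item stmt-HodgeConjecture-18574 · assembly · rank 1 · closed · proved by Summit.HodgeConjecture.HodgeConjecture.Theorems.tropicalKugaSatakeCayley_assembly_proof @ 0884fda4d2b4 (prover) · by planner
sources: Zharkov2020TropicalWeil, vanGeemenVerra2003QuaternionicPryms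
[assembly] EffectiveCayleyNonRealizability → KontsevichTransferKS → FormalCycleCriterion →
KSModelExists → CayleyHodgeRankTwo → ¬ HodgeConjecture (proof: the paragraph above; Baire for
ℚ-generic parameters is the only non-logical step). -/
@[route_item "route-HodgeConjecture-TropicalKugaSatakeCayley", crux]
def Assembly : Prop :=
  EffectiveCayleyNonRealizability → KontsevichTransferKS → FormalCycleCriterion → KSModelExists → CayleyHodgeRankTwo → ¬ _root_.HodgeConjecture

/-! D-0027 §2.1 — DECIDING THEOREM (planner-authored via `route open/edit --closes-file`; by planner-type-0185f1385c-0 2026-08-17T16:42:58Z):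
its hypotheses are this route's items and its conclusion the sub-problem Statement (glue_lint), and it elaborates with this file. -/

@[closes "route-HodgeConjecture-TropicalKugaSatakeCayley"] theorem closes (hA : Assembly) (h₁ : EffectiveCayleyNonRealizability) (h₂ : KontsevichTransferKS) (h₃ : FormalCycleCriterion) (s₃ : KSModelExists) (s₅ : CayleyHodgeRankTwo) : ¬ _root_.HodgeConjecture :=
  hA h₁ h₂ h₃ s₃ s₅

end Summit.HodgeConjecture.HodgeConjecture.Theses.TropicalKugaSatakeCayley
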